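import Summits.AtomisticToContinuum.BoseEinsteinCondensation.Theorems.BECConjugateDominationNearMinimiserStability
import Literature.MathematicalPhysics.QuantumManyBody.PeriodicGroundStateNondegenerateProofs
import HarnessLib

/-!
# Route BECHusimiAmplitudeGas — `PositivityReduction` (item stmt-AtomisticToContinuum-11998), part 1:
# stability of the condensate occupation between two near-minimisers (bounded pair potentials)

Helper file (`--supports stmt-AtomisticToContinuum-11998`). At fixed particle number `N` and side
`L > 0`, for a measurable, bounded, finite-range pair potential `v`, and every `ε > 0`, there is
`δ > 0` such that ANY TWO `δ`-near-minimisers `Ψ, Φ` of the periodic `N`-body energy satisfy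
`n₀(Ψ) ≤ n₀(Φ) + εN` (`condensateOccupation_le_of_nearMinimisers`). This is the two-sided form of
`NearMinimiserStability` (route `BECConjugateDomination`, where `Ψ` is an exact minimiser), and it is
what the positivity reduction needs: the nonnegative near-minimisers on which `PeriodicBECNonneg`
speaks are not minimisers.

## Proof

The tree's min–max dictionary (`PeriodicFormSpectrum`: `TwoModeData` of the compact embedding
`formEmbed` of the form domain, `E₀ = κ₁⁻¹ - 1`, `kyFanTwo = κ₁⁻¹ + κ₂⁻¹ - 2`), the gap inequality
`q(ψ) - E₀ ≥ (κ₂⁻¹ - κ₁⁻¹)(1 - |⟨φ₁, ψ⟩|²)` (`twoModeData_gap_mul_le`), the gap `κ₁⁻¹ < κ₂⁻¹` from the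
PROVED nondegeneracy of the bosonic torus ground state for bounded `v^per`
(`PeriodicGroundStateNondegenerate_holds`, Reed–Simon IV §XIII.12 via Feynman–Kac), a two-sided phase
alignment (`twoModeData_exists_phase_norm_sub_sq_le_of_near`: both near-minimisers are within `√t`
of a phase multiple of `φ₁`, hence within `2√t` of a phase multiple of each other), and the Lipschitz
bound `n₀(Ψ) ≤ n₀(c'Φ) + N(2η + η²)` (`condensateOccupation_le_of_sub_le`).
-/

noncomputable section

open MeasureTheory Filter Set Complex
open scoped ENNReal NNReal Topology ComplexConjugate InnerProductSpace

namespace Summit.AtomisticToContinuum.BoseEinsteinCondensation.Theorems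

open Literature.MathematicalPhysics.QuantumManyBody.BoseGas Literature.Analysis.InnerProduct
  Literature.MathematicalPhysics.QuantumManyBody

/-! ### Abstract Hilbert-space lemma: two near-minimisers are close up to a phase -/

section Abstract

variable {E : Type*} [NormedAddCommGroup E] [InnerProductSpace ℂ E]
variable {Q : Type*} [NormedAddCommGroup Q] [InnerProductSpace ℂ Q] [CompleteSpace Q] [CompleteSpace E]

/-- **Two near-minimisers are close up to a phase.** Let `d` be the spectral data of `ι : Q → E`
with a gap `κ₁⁻¹ < κ₂⁻¹`. If `u, w ∈ Q` are `E`-normalised near-minimisers,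
`‖u‖²_Q, ‖w‖²_Q ≤ κ₁⁻¹ + (κ₂⁻¹ - κ₁⁻¹) t/2` (`t ≥ 0`), then `‖ιu - c•ιw‖² ≤ 4t` for a phase `c`:
the gap inequality gives `1 - |⟪ιφ₁, ιu⟫|² ≤ t/2` (and the same for `w`), phase alignment puts
both within `√t` of a phase multiple of `ιφ₁`, and the triangle inequality concludes.
[cite: ReedSimonIV1978, Thm. XIII.1] -/
theorem twoModeData_exists_phase_norm_sub_sq_le_of_near {ι : Q →L[ℂ] E} (d : TwoModeData ι)
    (hgap : d.κ₁⁻¹ < d.κ₂⁻¹) {u w : Q} (hu : ‖ι u‖ = 1) (hw : ‖ι w‖ = 1) {t : ℝ} (ht : 0 ≤ t)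
    (hQu : ‖u‖ ^ 2 ≤ d.κ₁⁻¹ + (d.κ₂⁻¹ - d.κ₁⁻¹) * (t / 2))
    (hQw : ‖w‖ ^ 2 ≤ d.κ₁⁻¹ + (d.κ₂⁻¹ - d.κ₁⁻¹) * (t / 2)) :
    ∃ c : ℂ, ‖c‖ = 1 ∧ ‖ι u - c • ι w‖ ^ 2 ≤ 4 * t := by
  have hg0 : 0 < d.κ₂⁻¹ - d.κ₁⁻¹ := sub_pos.2 hgap
  have hp1 : ‖ι d.φ₁‖ = 1 := d.norm_map_φ₁
  -- overlap of a near-minimiser with the ground state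
  have hover : ∀ {z : Q}, ‖ι z‖ = 1 → ‖z‖ ^ 2 ≤ d.κ₁⁻¹ + (d.κ₂⁻¹ - d.κ₁⁻¹) * (t / 2) →
      1 - ‖⟪ι z, ι d.φ₁⟫_ℂ‖ ^ 2 ≤ t / 2 := by
    intro z hz hQz
    have hgz := twoModeData_gap_mul_le d hz
    have : (d.κ₂⁻¹ - d.κ₁⁻¹) * (1 - ‖⟪ι d.φ₁, ι z⟫_ℂ‖ ^ 2) ≤ (d.κ₂⁻¹ - d.κ₁⁻¹) * (t / 2) := by
      linarith
    have h := le_of_mul_le_mul_left this hg0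
    rwa [norm_inner_symm] at h
  -- phase alignment of each near-minimiser with `φ₁`
  have halign : ∀ {z : Q}, ‖ι z‖ = 1 → ‖z‖ ^ 2 ≤ d.κ₁⁻¹ + (d.κ₂⁻¹ - d.κ₁⁻¹) * (t / 2) →
      ∃ a : ℂ, ‖a‖ = 1 ∧ ‖ι z - a • ι d.φ₁‖ ≤ Real.sqrt t := by
    intro z hz hQz
    obtain ⟨a, ha, hdist⟩ := exists_phase_norm_sub_sq_le hz hp1
    refine ⟨a, ha, ?_⟩
    have hsq : ‖ι z - a • ι d.φ₁‖ ^ 2 ≤ t := by linarith [hover hz hQz]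
    calc ‖ι z - a • ι d.φ₁‖ = Real.sqrt (‖ι z - a • ι d.φ₁‖ ^ 2) := by
          rw [Real.sqrt_sq (norm_nonneg _)]
      _ ≤ Real.sqrt t := Real.sqrt_le_sqrt hsq
  obtain ⟨a, ha, hau⟩ := halign hu hQu
  obtain ⟨b, hb, hbw⟩ := halign hw hQw
  have hb0 : b ≠ 0 := fun h => by rw [h, norm_zero] at hb; exact zero_ne_one hb
  refine ⟨a / b, by rw [norm_div, ha, hb, div_one], ?_⟩
  have hdecomp : ι u - (a / b) • ι w = (ι u - a • ι d.φ₁) + (a / b) • (b • ι d.φ₁ - ι w) := by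
    rw [smul_sub, smul_smul, div_mul_cancel₀ a hb0]
    abel
  have hnorm : ‖ι u - (a / b) • ι w‖ ≤ 2 * Real.sqrt t := by
    calc ‖ι u - (a / b) • ι w‖ = ‖(ι u - a • ι d.φ₁) + (a / b) • (b • ι d.φ₁ - ι w)‖ := by rw [hdecomp]
      _ ≤ ‖ι u - a • ι d.φ₁‖ + ‖(a / b) • (b • ι d.φ₁ - ι w)‖ := norm_add_le _ _
      _ = ‖ι u - a • ι d.φ₁‖ + ‖ι w - b • ι d.φ₁‖ := by
          rw [norm_smul, norm_div, ha, hb, div_one, one_mul, norm_sub_rev (b • ι d.φ₁) (ι w)]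
      _ ≤ Real.sqrt t + Real.sqrt t := add_le_add hau hbw
      _ = 2 * Real.sqrt t := by ring
  calc ‖ι u - (a / b) • ι w‖ ^ 2 ≤ (2 * Real.sqrt t) ^ 2 := pow_le_pow_left₀ (norm_nonneg _) hnorm 2
    _ = 4 * t := by rw [mul_pow, Real.sq_sqrt ht]; norm_num

end Abstract

/-! ### The theorem: two near-minimisers have close condensate occupations -/
set_option maxHeartbeats 400000 in
/-- **Stability of the condensate occupation between two near-minimisers (bounded pair potentials).**
For a measurable pair potential `v ≥ 0` of finite range (`v(r) = 0` for `r > R₀`) and bounded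
(`v ≤ M`), fixed `N`, `L > 0` and `ε > 0`, there is `δ > 0` such that any two `δ`-near-minimisers
`Ψ, Φ` of the periodic `N`-body energy (periodic `C¹` Bose trial states with
`periodicEnergy ≤ periodicGroundStateEnergy + δ`) satisfy `n₀(Ψ) ≤ n₀(Φ) + εN`. Min–max in the form
domain, the spectral gap from the nondegeneracy of the bosonic torus ground state
(`PeriodicGroundStateNondegenerate_holds`), two-sided phase alignment
(`twoModeData_exists_phase_norm_sub_sq_le_of_near`, `‖Ψ - c'Φ‖²_cell ≤ η²` for
`δ = gap·η²/8`), and the Lipschitz bound `n₀(Ψ) ≤ n₀(c'Φ) + N(2η + η²)`, `η = min(ε/3, 1)`.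
[cite: ReedSimonIV1978, Thm. XIII.1 and §XIII.12 Thms XIII.43–XIII.46] -/
theorem condensateOccupation_le_of_nearMinimisers {v : ℝ → ℝ≥0∞} (hmeas : Measurable v) {R₀ : ℝ}
    (hR₀ : ∀ r, R₀ < r → v r = 0) {M : ℝ≥0} (hM : ∀ r, v r ≤ M) (N : ℕ) {L : ℝ} (hL : 0 < L)
    {ε : ℝ} (hε : 0 < ε) :
    ∃ δ : ℝ≥0∞, 0 < δ ∧ ∀ Ψ Φ : PeriodicTrialState N L,
      periodicEnergy v Ψ ≤ periodicGroundStateEnergy v N L + δ →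
      periodicEnergy v Φ ≤ periodicGroundStateEnergy v N L + δ →
      condensateOccupation N L Ψ.ψ ≤ condensateOccupation N L Φ.ψ + ENNReal.ofReal (ε * N) := by
  rcases N with _ | n
  · -- no particles: `n₀ = 0`
    refine ⟨1, one_pos, fun Ψ Φ _ _ => ?_⟩
    simp [condensateOccupation, occupation]
  -- bounded periodisation, `W ∈ L¹(cell)`
  obtain ⟨C, hC⟩ := exists_bound_periodizedPotential hL hM hR₀
  have hW : ∫⁻ X in cellN (n + 1) L, periodicInteraction v L X ≠ ⊤ :=
    lintegral_periodicInteraction_ne_top hC (n + 1)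
  -- the graph map into the form domain `Q` and the embedding `ι : Q → H = L²`
  set J := (graphEmbed hL hmeas hW).codRestrict (formDomain hL hmeas hW)
    (graphEmbed_mem_formDomain hL hmeas hW) with hJ
  have hJapply : ∀ F : periodicCore (n + 1) L,
      J F = ⟨graphEmbed hL hmeas hW F, graphEmbed_mem_formDomain hL hmeas hW F⟩ := fun F => rfl
  set ι := formEmbed hL hmeas hW with hι
  -- spectral data of the two lowest eigenvalues, and the gap
  obtain ⟨d⟩ := nonempty_twoModeData hL hmeas hW (Nat.succ_pos n)
  have hE₀ : periodicGroundStateEnergy v (n + 1) L = ENNReal.ofReal (d.κ₁⁻¹ - 1) :=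
    periodicGroundStateEnergy_eq_ofReal d
  have h1 : 1 ≤ d.κ₁⁻¹ := twoModeData_one_le_inv_κ₁ d
  have hgap : d.κ₁⁻¹ < d.κ₂⁻¹ := by
    have hlt := PeriodicGroundStateNondegenerate_holds (n + 1) L v (Nat.succ_pos n) hL hmeas ⟨C, hC⟩
    rw [hE₀, kyFanTwo_eq_ofReal d,
      show (2 : ℝ≥0∞) * ENNReal.ofReal (d.κ₁⁻¹ - 1) = ENNReal.ofReal (2 * (d.κ₁⁻¹ - 1)) by
        rw [ENNReal.ofReal_mul zero_le_two, ENNReal.ofReal_ofNat],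
      ENNReal.ofReal_lt_ofReal_iff_of_nonneg (by linarith)] at hlt
    linarith
  have hg0 : 0 < d.κ₂⁻¹ - d.κ₁⁻¹ := sub_pos.2 hgap
  -- the tolerance
  set η : ℝ := min (ε / 3) 1 with hη
  have hη0 : 0 < η := lt_min (by linarith) one_pos
  have hη1 : η ≤ 1 := min_le_right _ _
  have hηε : 2 * η + η ^ 2 ≤ ε := by nlinarith [min_le_left (ε / 3) 1]
  refine ⟨ENNReal.ofReal ((d.κ₂⁻¹ - d.κ₁⁻¹) * (η ^ 2 / 8)),
    ENNReal.ofReal_pos.2 (by positivity), fun Ψ Φ hΨ hΦ => ?_⟩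
  -- the vectors
  set FΨ : periodicCore (n + 1) L := ⟨Ψ.ψ, Ψ.mem_periodicCore⟩ with hFΨ
  set FΦ : periodicCore (n + 1) L := ⟨Φ.ψ, Φ.mem_periodicCore⟩ with hFΦ
  have huΨ : ‖ι (J FΨ)‖ = 1 := norm_formEmbed_graphEmbed_trialState hL hmeas hW Ψ
  have huΦ : ‖ι (J FΦ)‖ = 1 := norm_formEmbed_graphEmbed_trialState hL hmeas hW Φ
  have hnormJ : ∀ F : periodicCore (n + 1) L, ‖J F‖ = ‖graphEmbed hL hmeas hW F‖ := fun F => by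
    rw [hJapply]; rfl
  have hQΨ : ‖J FΨ‖ ^ 2 = 1 + (periodicEnergy v Ψ).toReal := by
    rw [hnormJ]; exact norm_graphEmbed_sq_trialState hL hmeas hW Ψ
  have hQΦ : ‖J FΦ‖ ^ 2 = 1 + (periodicEnergy v Φ).toReal := by
    rw [hnormJ]; exact norm_graphEmbed_sq_trialState hL hmeas hW Φ
  -- energies as real numbers
  have hEreal : ∀ {Θ : PeriodicTrialState (n + 1) L},
      periodicEnergy v Θ ≤ periodicGroundStateEnergy v (n + 1) L +
        ENNReal.ofReal ((d.κ₂⁻¹ - d.κ₁⁻¹) * (η ^ 2 / 8)) →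
      (periodicEnergy v Θ).toReal ≤ d.κ₁⁻¹ - 1 + (d.κ₂⁻¹ - d.κ₁⁻¹) * (η ^ 2 / 8) := by
    intro Θ hΘ
    rw [hE₀, ← ENNReal.ofReal_add (by linarith) (by positivity)] at hΘ
    have := ENNReal.toReal_mono ENNReal.ofReal_ne_top hΘ
    rwa [ENNReal.toReal_ofReal (by nlinarith [sq_nonneg η])] at this
  have hEΨ := hEreal hΨ
  have hEΦ := hEreal hΦ
  -- the abstract stability argument: `‖ιΨ - c'•ιΦ‖² ≤ η²`
  obtain ⟨c', hc', hdist'⟩ := twoModeData_exists_phase_norm_sub_sq_le_of_near (ι := ι) d hgap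
    (u := J FΨ) (w := J FΦ) huΨ huΦ (t := η ^ 2 / 4) (by positivity) (by linarith) (by linarith)
  have hdist : ‖ι (J FΨ) - c' • ι (J FΦ)‖ ^ 2 ≤ η ^ 2 := by linarith
  -- back to functions on the cell: `∫_cell |Ψ - c'Φ|² ≤ η²`
  have hcore : ι (J FΨ) - c' • ι (J FΦ) = ι (J (FΨ - c' • FΦ)) := by
    simp only [map_sub, map_smul]
  have hfun : ((FΨ - c' • FΦ : periodicCore (n + 1) L) : Config (n + 1) → ℂ) =
      fun X => Ψ.ψ X - c' * Φ.ψ X := by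
    ext X
    simp [hFΨ, hFΦ]
  have hcontd : Continuous fun X => Ψ.ψ X - c' * Φ.ψ X :=
    Ψ.contDiff.continuous.sub (continuous_const.mul Φ.contDiff.continuous)
  have hcell : ∫⁻ X in cellN (n + 1) L, (‖Ψ.ψ X - c' * Φ.ψ X‖₊ : ℝ≥0∞) ^ 2 ≤
      ENNReal.ofReal (η ^ 2) := by
    have hnorm : ‖ι (J (FΨ - c' • FΦ))‖ ^ 2 =
        (∫⁻ X in cellN (n + 1) L,
          (‖((FΨ - c' • FΦ : periodicCore (n + 1) L) : Config (n + 1) → ℂ) X‖₊ : ℝ≥0∞) ^ 2).toReal :=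
      norm_formEmbed_graphEmbed_sq hL hmeas hW (FΨ - c' • FΦ)
    simp only [hfun, ← hcore] at hnorm
    have hfin' : (∫⁻ X in cellN (n + 1) L, (‖Ψ.ψ X - c' * Φ.ψ X‖₊ : ℝ≥0∞) ^ 2) ≠ ⊤ :=
      (lintegral_cellN_sq_lt_top L hcontd).ne
    rw [← ENNReal.ofReal_toReal hfin', ← hnorm]
    exact ENNReal.ofReal_le_ofReal hdist
  -- the Lipschitz estimate for `n₀`
  have hc'n : ((‖c'‖₊ : ℝ≥0) : ℝ≥0∞) = 1 := by
    rw [← ENNReal.coe_one, ENNReal.coe_inj, ← NNReal.coe_inj, coe_nnnorm, hc', NNReal.coe_one]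
  have hcontg : Continuous fun X => c' * Φ.ψ X := continuous_const.mul Φ.contDiff.continuous
  have hg1 : ∫⁻ X in cellN (n + 1) L, (‖c' * Φ.ψ X‖₊ : ℝ≥0∞) ^ 2 ≤ 1 := by
    have hX : ∀ X, (‖c' * Φ.ψ X‖₊ : ℝ≥0∞) ^ 2 = (‖Φ.ψ X‖₊ : ℝ≥0∞) ^ 2 := fun X => by
      rw [nnnorm_mul, ENNReal.coe_mul, mul_pow, hc'n, one_pow, one_mul]
    simp only [hX]
    rw [Φ.norm_eq]
  have hmain := condensateOccupation_le_of_sub_le hL Ψ.contDiff.continuous hcontg hg1 hη0 hcell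
  rw [condensateOccupation_const_mul hL c' Φ.ψ, hc'n, one_pow, one_mul] at hmain
  refine hmain.trans (add_le_add le_rfl (ENNReal.ofReal_le_ofReal ?_))
  rw [mul_comm]
  exact mul_le_mul_of_nonneg_right hηε (Nat.cast_nonneg _)

end Summit.AtomisticToContinuum.BoseEinsteinCondensation.Theorems

end
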